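import Literature.NumberTheory.Automorphic.RankinSelbergLocal
import HarnessLib

/-!
# Proofs for `RankinSelbergLocal`: `W ↦ W̃` preserves Whittaker spaces

This file discharges the named fact
`Literature.NumberTheory.Automorphic.tildeFn_mem_whittakerSpace` of
`Literature/NumberTheory/Automorphic/RankinSelbergLocal.lean`:
if `W ∈ 𝒲_n(ψ)` (left `(U_n, ψ_U)`-equivariant and right-invariant under an open subgroup) then
`W̃(g) = W(w_n ᵗg⁻¹)` lies in `𝒲_n(ψ⁻¹)`.

Source: H. Jacquet, I. Piatetski-Shapiro, J. Shalika, *Rankin–Selberg convolutions*,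
Amer. J. Math. 105 (1983), §2, (2.1) (`W̃ ∈ 𝒲(π̃, ψ̄)` for `W ∈ 𝒲(π, ψ)`); J. Cogdell, *Analytic
theory of `L`-functions for `GL_n`*, in Bernstein–Gelbart (eds.), *An Introduction to the Langlands
Program* (Birkhäuser 2003), §2.2 ("for `W ∈ 𝒲(π, ψ)` we set `W̃(g) = W(w_n g^ι) ∈ 𝒲(π̃, ψ⁻¹)`",
`g^ι = ᵗg⁻¹`).

## Proof

* `weylLong_mul_mul_weylLong_apply`: `(w_n M w_n)_{ij} = M_{rev i, rev j}` (Mathlib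
  `PEquiv.toMatrix_toPEquiv_mul`, `PEquiv.mul_toMatrix_toPEquiv`), and `w_n⁻¹ = w_n`
  (`weylLong_inv`).
* `weylLong_mul_glTransposeInv_mul_weylLong_mem`: for `u ∈ U_n` the matrix `w_n ᵗu⁻¹ w_n` is again
  upper unitriangular (its `(i, j)` entry is `(u⁻¹)_{rev j, rev i}`), and its super-diagonal sum is
  `∑ᵢ (u⁻¹)_{i,i+1} = -∑ᵢ u_{i,i+1}` (`superdiagSum_weylLong_conj`, `superdiagSum_inv`), whence
  `ψ_U(w_n ᵗu⁻¹ w_n) = ψ⁻¹_U(u)` (`whittakerCharFun_weylLong_conj`).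
* `tildeFn_mem_whittakerSpace_holds`: `w_n ᵗ(u g)⁻¹ = (w_n ᵗu⁻¹ w_n) (w_n ᵗg⁻¹)` gives the
  `ψ⁻¹_U`-equivariance; the open subgroup `K` of right-invariance is replaced by its preimage under
  the continuous homomorphism `g ↦ ᵗg⁻¹` (`GaloisRepresentations.glTransposeInv`).

No new definitions or named facts are introduced (D-0026).
-/

set_option autoImplicit false

open Matrix

namespace Literature.NumberTheory.Automorphic

section TildeProofs

variable {R : Type*} [CommRing R] {n : ℕ}

/-- `w_n⁻¹ = w_n`: the long Weyl element is an involution. [folklore] -/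
lemma weylLong_inv (n : ℕ) (R : Type*) [CommRing R] : (weylLong n R)⁻¹ = weylLong n R := by
  rw [weylLong, ← map_inv, Equiv.Perm.inv_def, Fin.revPerm_symm]

/-- `w_n w_n = 1`. [folklore] -/
lemma weylLong_mul_self (n : ℕ) (R : Type*) [CommRing R] : weylLong n R * weylLong n R = 1 :=
  calc weylLong n R * weylLong n R = (weylLong n R)⁻¹ * weylLong n R := by rw [weylLong_inv]
    _ = 1 := inv_mul_cancel _

/-- Entries of a conjugate by the long Weyl element: `(w_n M w_n)_{ij} = M_{rev i, rev j}`.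
[folklore] -/
lemma weylLong_mul_mul_weylLong_apply (M : Matrix (Fin n) (Fin n) R) (i j : Fin n) :
    ((weylLong n R : GL (Fin n) R) * M * (weylLong n R : GL (Fin n) R)) i j =
      M (Fin.rev i) (Fin.rev j) := by
  rw [coe_weylLong, Equiv.Perm.permMatrix, PEquiv.toMatrix_toPEquiv_mul,
    PEquiv.mul_toMatrix_toPEquiv]
  simp

/-- `superdiagSum u⁻¹ = -superdiagSum u`. [folklore] -/
lemma superdiagSum_inv (u : ↥(upperUnitriangular (Fin n) R)) :
    superdiagSum u⁻¹ = -superdiagSum u := by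
  have h := superdiagSum_mul u⁻¹ u
  rw [inv_mul_cancel, superdiagSum_one] at h
  linear_combination -h

variable [TopologicalSpace R]

/-- For `u ∈ U_n`, the element `w_n ᵗu⁻¹ w_n` again lies in `U_n`. [folklore] -/
lemma weylLong_mul_glTransposeInv_mul_weylLong_mem {u : GL (Fin n) R}
    (hu : u ∈ upperUnitriangular (Fin n) R) :
    weylLong n R * GaloisRepresentations.glTransposeInv (Fin n) R u * weylLong n R ∈
      upperUnitriangular (Fin n) R := by
  have hu' := (mem_upperUnitriangular_iff _).1 (inv_mem hu)
  rw [mem_upperUnitriangular_iff]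
  simp only [Units.val_mul, GaloisRepresentations.coe_glTransposeInv_apply]
  refine ⟨fun i j hij => ?_, fun i => ?_⟩
  · rw [weylLong_mul_mul_weylLong_apply, Matrix.transpose_apply]
    refine hu'.1 ?_
    simp only [id, Fin.lt_def, Fin.val_rev] at hij ⊢
    omega
  · rw [weylLong_mul_mul_weylLong_apply, Matrix.transpose_apply]
    exact hu'.2 _

/-- The super-diagonal sum of `w_n ᵗu⁻¹ w_n` is that of `u⁻¹`. [folklore] -/
lemma superdiagSum_weylLong_conj (u : ↥(upperUnitriangular (Fin n) R)) :
    superdiagSum ⟨weylLong n R * GaloisRepresentations.glTransposeInv (Fin n) R u * weylLong n R,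
        weylLong_mul_glTransposeInv_mul_weylLong_mem u.2⟩ = superdiagSum u⁻¹ := by
  simp only [superdiagSum_def, Units.val_mul, GaloisRepresentations.coe_glTransposeInv_apply,
    weylLong_mul_mul_weylLong_apply, Matrix.transpose_apply, Subgroup.coe_inv]
  rw [Finset.sum_comm, ← Equiv.sum_comp Fin.revPerm]
  refine Fintype.sum_congr _ _ fun a => ?_
  rw [← Equiv.sum_comp Fin.revPerm]
  refine Fintype.sum_congr _ _ fun b => ?_
  simp only [Fin.revPerm_apply, Fin.rev_rev, Fin.val_rev]
  have : ((n - (b + 1) + 1 = n - (a + 1)) ↔ ((a : ℕ) + 1 = b)) := by omega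
  simp only [this]

/-- `ψ_U(w_n ᵗu⁻¹ w_n) = ψ⁻¹_U(u)`. [folklore] -/
lemma whittakerCharFun_weylLong_conj (ψ : AddChar R Circle) (u : ↥(upperUnitriangular (Fin n) R)) :
    whittakerCharFun ψ ⟨weylLong n R * GaloisRepresentations.glTransposeInv (Fin n) R u *
        weylLong n R, weylLong_mul_glTransposeInv_mul_weylLong_mem u.2⟩ =
      whittakerCharFun ψ⁻¹ u := by
  rw [whittakerCharFun_apply, whittakerCharFun_apply, superdiagSum_weylLong_conj, superdiagSum_inv,
    AddChar.inv_apply]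

end TildeProofs

section TildeHolds

variable {F : Type*} [Field F] [TopologicalSpace F] {n : ℕ}

/-- **Discharge of `tildeFn_mem_whittakerSpace`** (Jacquet–Piatetski-Shapiro–Shalika 1983, §2
(2.1); Cogdell, *Analytic theory of L-functions for GL_n*, §2.2): if `W ∈ 𝒲_n(ψ)` then
`W̃ = W(w_n ᵗ(·)⁻¹) ∈ 𝒲_n(ψ⁻¹)`. Equivariance: for `u ∈ U_n`,
`w_n ᵗ(ug)⁻¹ = (w_n ᵗu⁻¹ w_n) · w_n ᵗg⁻¹` with `w_n ᵗu⁻¹ w_n ∈ U_n` of generic character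
`ψ_U(w_n ᵗu⁻¹ w_n) = ψ(∑ (u⁻¹)_{i,i+1}) = ψ(-∑ u_{i,i+1}) = ψ⁻¹_U(u)`; uniform smoothness: the open
subgroup `K` is replaced by its preimage under the continuous homomorphism `g ↦ ᵗg⁻¹`.
[cite: JacquetPiatetskiShapiroShalika1983, §2 eq. (2.1)] -/
theorem tildeFn_mem_whittakerSpace_holds : tildeFn_mem_whittakerSpace (F := F) (n := n) := by
  intro ψ W hW
  obtain ⟨hWu, K, hK, hWK⟩ := hW
  refine ⟨fun u g => ?_,
    K.comap (GaloisRepresentations.glTransposeInv (Fin n) F).toMonoidHom, ?_, ?_⟩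
  · rw [tildeFn_apply, tildeFn_apply, map_mul, ← whittakerCharFun_weylLong_conj ψ u, ← hWu]
    congr 1
    simp only [mul_assoc]
    rw [← mul_assoc (weylLong n F) (weylLong n F), weylLong_mul_self, one_mul]
  · exact hK.preimage (map_continuous (GaloisRepresentations.glTransposeInv (Fin n) F))
  · intro k hk g
    rw [tildeFn_apply, tildeFn_apply, map_mul, ← mul_assoc]
    exact hWK _ (Subgroup.mem_comap.1 hk) _

end TildeHolds

end Literature.NumberTheory.Automorphic
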